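import Summits.HodgeConjecture.HodgeConjecture.Theorems.Ring2AbelianAllAndreRetractPencils
import Literature.AlgebraicGeometry.HodgeTheory.HyperplaneSectionMonodromySmoothLocus
import HarnessLib

/-!
# Ring 2 · sub-cell AbelianAll (ALL ABELIAN VARIETIES), André axis, part XXXIII-b — FIBRE PRODUCTS OF PENCILS: the fibre
# product `𝒴 ×_S 𝒳 ⟶ S` of two compact pencils of abelian varieties over the SAME curve is a compact pencil of abelian
# varieties of relative dimension `d' + d` (fibres `𝒴_s × 𝒳_s`), CM-pointed at the common CM points, and it RETRACTS onto
# `𝒳` over `S` through the zero section of `𝒴`; hence (part XXXIII-a) the lift / transport statements of `𝒴 ×_S 𝒳 ⟶ S` in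
# degree `2(p + d')` give those of `f` in degree `2p` — in particular for the FIBRE SQUARE `𝒳 ×_S 𝒳 ⟶ S` (degree shift `d`)

HONEST FRAMING (page 1, verbatim): **research route, not a corollary; conditional on HC_CM plus one named
minimal statement.** Cell line: research route conditional on HC_CM; not a corollary; Q11.4-sentence-2 already
refuted in dim ≥ 3. Nothing in this file proves a case of the Hodge conjecture for an abelian variety; `HC_CM`, `HC_AV`
do not occur; no node is born (0 `def`), no named fact is used, no `sorry`; axioms standard; nothing is claimed minimal.

## What this part does (brief (ii): "restrict the class of auxiliary varieties")

Part XXXII padded a pencil by a CONSTANT abelian variety (`B × 𝒳 = (B × S) ×_S 𝒳`). The general padding is the fibre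
product with ANOTHER PENCIL over the same base: for compact pencils `g : 𝒴 ⟶ S`, `f : 𝒳 ⟶ S` of abelian varieties of
relative dimensions `d'`, `d` (the tree's `Motives.familyPullback g f = 𝒴 ×_S 𝒳`, projections `fst` to `𝒴` and `snd` to
`𝒳`; the pencil is `snd ≫ f`):

* §1 `exists_fiberOver_familyPullback_iso` — **`(𝒴 ×_S 𝒳)_s ≅ 𝒴_s × 𝒳_s`** compatibly with the two projections (pasting
  of cartesian squares: `𝒴_s × 𝒳_s` is `(𝒴 ×_S 𝒳) ×_𝒳 𝒳_s`); `isSmoothProjectiveFamily_familyPullback_snd_comp` — `snd ≫ f`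
  is a smooth projective family of relative dimension `d' + d`; **`isSmoothProjective_familyPullback_of_pencils`** — the
  total space `𝒴 ×_S 𝒳` is a smooth projective `(d' + d + 1)`-fold (smooth: composite of a base change of `f` with
  `𝒴 → Spec ℂ`; projective: `(ι, g) : 𝒴 ↪ ℙᴺ × S` is a closed immersion, so `𝒴 ×_S 𝒳 ↪ ℙᴺ × 𝒳` by the tree's
  `exists_isClosedImmersion_familyPullback`, and `ℙᴺ × 𝒳` is projective (Segre); geometrically irreducible: a smooth
  projective family over the irreducible `𝒳`, the tree's `irreducibleSpace_of_isSmoothProjectiveFamily`, then integral ⟹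
  geometrically integral over `ℂ`); **`isCompactAbelianPencil_familyPullback_snd_comp`** — `𝒴 ×_S 𝒳 ⟶ S` IS A COMPACT PENCIL
  OF ABELIAN VARIETIES of relative dimension `d' + d` (zero section `(e', e)`, fibres `B_s × A_s`);
  `mem_cmLocus_familyPullback_snd_comp` — a point CM for both `g` and `f` is CM for `𝒴 ×_S 𝒳 ⟶ S`.
* §2 `exists_section_familyPullback_snd` — **`𝒳` is an `S`-RETRACT of `𝒴 ×_S 𝒳`**: `σ = (f ≫ e', 𝟙) : 𝒳 ⟶ 𝒴 ×_S 𝒳` (slice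
  through the zero section `e'` of `𝒴`) has `σ ≫ snd = 𝟙`.
* §3 THE DESCENT (part XXXIII-a instantiated): **`comap_le_sup_of_familyPullback`** — the lift `(L)_t(p + d')` of
  `𝒴 ×_S 𝒳 ⟶ S` gives the lift `(L)_t(p)` of `f`; **`comap_le_comap_of_familyPullback`** — transport from `t` to `s` in
  degree `2(p + d')` along `𝒴 ×_S 𝒳 ⟶ S` gives transport in degree `2p` along `f`; and the FIBRE SQUARE (`𝒴 = 𝒳`, `g = f`):
  `isCompactAbelianPencil_square`, `mem_cmLocus_square`, **`comap_le_sup_of_square`**, **`comap_le_comap_of_square`** —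
  the André-axis statements of `f` in degree `2p` follow from those of `𝒳 ×_S 𝒳 ⟶ S` (relative dimension `2d`) in
  degree `2(p + d)`, i.e. AT OR ABOVE THE MIDDLE of the square (part XXXIII-c: the node-level equivalences "(L), (L∀), (4),
  (2), (3) ⟺ their restrictions to fibre squares", and the reading).

HABITAT READING (prose, nothing typed). The content of `𝒴 ×_S 𝒳 ⟶ S` beyond its two retracts `𝒴`, `𝒳` is carried by
the COUPLED invariant classes `⊂ ⊕_{a, b > 0} Hᵃ(𝒴_s) ⊗ Hᵇ(𝒳_s)`: e.g. for two pencils of abelian THREEFOLDS with an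
imaginary quadratic `K ⊂ End_S` acting with signatures `(2,1)` on `𝒴/S` and `(1,2)` on `𝒳/S` (a curve `S` in the product
of two Picard modular surfaces), the fibres `𝒴_s × 𝒳_s` are abelian SIXFOLDS OF WEIL TYPE `(3,3)` whose Hodge–Weil
classes `∧³W_{𝒴_s} ⊗ ∧³W̄_{𝒳_s} ⊂ H³ ⊗ H³` are fibrewise Hodge, multiplied under monodromy by the character
`det_K(ρ_𝒴) · conj(det_K(ρ_𝒳))` with values in the roots of unity of `K` (integral unitary monodromy) — hence monodromy-INVARIANT
after a connected finite étale base change `S' → S`, along which compact abelian pencils pull back (seat b05's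
`isCompactAbelianPencil_familyPullback_snd`) — and, when `𝒴_s`, `𝒳_s` are not isogenous, NOT in the algebra of divisor classes
(`NS = ℚθ ⊕ ℚθ'`, the Weil classes sit in `H³ ⊗ H³`): the first cell `(6, 3)` of the André axis (part XXXII-c) is inhabited by
fibre products of pencils of threefolds. (At a point `t` with `𝒳_t ≅ 𝒴_t^c` — `𝒴_t` with the conjugate `K`-action — every Weil
class is a rational cubic polynomial in the two `K`-linear polarisation divisor classes of `𝒴_t × 𝒴_t`, over `ℂ` the cube `D₁³`
of the `W ⊗ W̄`-component of the polarisation: an anchor with an EXPLICIT cycle.) No node is filed for this habitat; it is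
recorded for the find-the-cycle list (RING2-MAP §AbelianAll gen 25).

What is NOT claimed: any converse of §3; that fibre products exhaust the cell `(6, 3)`; anything about `HC_CM`; any case
of HC. EDGE LABELS: every row K (kernel, fact-free).

References: Hartshorne1977 (II.3 p. 89 "base extension", II Ex. 4.9, III Prop. 10.1); GortzWedhorn2020 (Prop. 14.57,
Cor. 13.72); Liu2002 (Ch. 4 Prop. 3.8); MumfordGIT (Thm. 6.14: abelian schemes); Fulton1998 (Prop. 1.7, Thm. 6.2 (a));
Milne2020HodgeClassesAV (Prop. 1, p. 7); Abdulali1994FamiliesAV ((1.1) p. 1122); Andre1996Motifs (§6.3 footnote (2)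
p. 31, Lemme 6.3.1); MoonenZarhin1999LowDim (§0: Weil type); vanGeemen1994HodgeAV (§5: products of Weil type);
Deligne1982HodgeCycles (§4: `SU(2,1)`-families, §6 proof of Prop. 6.1).
-/

noncomputable section

set_option linter.dupNamespace false

namespace Summit.HodgeConjecture.HodgeConjecture.Ring2.AbelianAll

open CategoryTheory CategoryTheory.Limits AlgebraicGeometry MonoidalCategory CartesianMonoidalCategory
open Literature.AlgebraicGeometry Literature.AlgebraicGeometry.Motives
open Literature.AlgebraicGeometry.HodgeTheory
open Literature.AlgebraicGeometry.Deligne1982 (cmLocus)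
open Literature.AlgebraicGeometry.Milne1999 (IsOfCMType)

variable {𝒳 𝒴 S : SchemeOver ℂ}

/-! ## §1 The fibre product `𝒴 ×_S 𝒳 ⟶ S` of two families over the same base -/

/-- **`(𝒴 ×_S 𝒳)_s ≅ 𝒴_s × 𝒳_s`, compatibly with the two projections.** The product `𝒴_s × 𝒳_s` is the pullback of
`𝒴_s → Spec ℂ ← 𝒳_s`; pasted with the fibre square of `g` it is `𝒴 ×_S 𝒳_s` over `𝒳_s ⟶ S`, hence (cancelling the
cartesian square of `𝒴 ×_S 𝒳`) it is `(𝒴 ×_S 𝒳) ×_𝒳 𝒳_s`, and pasted with the fibre square of `f` it is the fibre of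
`snd ≫ f` over `s`. [cite: Hartshorne1977, II.3 (p. 89)] -/
theorem exists_fiberOver_familyPullback_iso (g : 𝒴 ⟶ S) (f : 𝒳 ⟶ S) (s : ComplexPoints S) :
    ∃ e : fiberOver g s ⊗ fiberOver f s ≅ fiberOver (familyPullback.snd g f ≫ f) s,
      e.hom ≫ fiberι (familyPullback.snd g f ≫ f) s ≫ familyPullback.fst g f = fst _ _ ≫ fiberι g s ∧
        e.hom ≫ fiberι (familyPullback.snd g f ≫ f) s ≫ familyPullback.snd g f = snd _ _ ≫ fiberι f s := by
  have hP : IsPullback (familyPullback.fst g f) (familyPullback.snd g f) g f := familyPullback.isPullback g f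
  have h1 : IsPullback (fiberι f s) (fiberOverToSpec f s) f s := familyPullback.isPullback f s
  have h2 : IsPullback (fiberι g s) (fiberOverToSpec g s) g s := familyPullback.isPullback g s
  -- the product of the two fibres is a pullback over `Spec ℂ`
  have tSpec : IsTerminal (specOver ℂ ℂ) := IsTerminal.ofUniqueHom toSpecOver fun _ m ↦ Motives.eq_toSpecOver m
  have hprod : IsPullback (fst (fiberOver g s) (fiberOver f s)) (snd (fiberOver g s) (fiberOver f s))
      (fiberOverToSpec g s) (fiberOverToSpec f s) := by
    have h := IsPullback.of_is_product' (tensorProductIsBinaryProduct (fiberOver g s) (fiberOver f s)) tSpec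
    rwa [Motives.eq_toSpecOver (tSpec.from (fiberOver g s)), Motives.eq_toSpecOver (tSpec.from (fiberOver f s)),
      ← Motives.eq_toSpecOver (fiberOverToSpec g s), ← Motives.eq_toSpecOver (fiberOverToSpec f s)] at h
  -- `𝒴_s × 𝒳_s ⟶ 𝒴` over `𝒳_s ⟶ S`
  have hbig : IsPullback (fst (fiberOver g s) (fiberOver f s) ≫ fiberι g s) (snd (fiberOver g s) (fiberOver f s)) g
      (fiberι f s ≫ f) := by
    rw [fiberι_comp f s]
    exact hprod.paste_horiz h2
  -- the comparison map into `𝒴 ×_S 𝒳`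
  have hτ : (fst (fiberOver g s) (fiberOver f s) ≫ fiberι g s) ≫ g = (snd (fiberOver g s) (fiberOver f s) ≫ fiberι f s) ≫ f := by
    rw [Category.assoc, Category.assoc]
    exact hbig.w
  have hC : IsPullback (hP.lift _ _ hτ) (snd (fiberOver g s) (fiberOver f s)) (familyPullback.snd g f) (fiberι f s) := by
    refine IsPullback.of_right ?_ (hP.lift_snd _ _ hτ) hP
    rw [hP.lift_fst _ _ hτ]
    exact hbig
  have hfib : IsPullback (fiberι (familyPullback.snd g f ≫ f) s) (fiberOverToSpec (familyPullback.snd g f ≫ f) s)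
      (familyPullback.snd g f ≫ f) s := familyPullback.isPullback _ s
  have hbig' := hC.paste_vert h1
  refine ⟨IsPullback.isoIsPullback _ _ hbig' hfib, ?_, ?_⟩
  · rw [← Category.assoc, IsPullback.isoIsPullback_hom_fst, hP.lift_fst _ _ hτ]
  · rw [← Category.assoc, IsPullback.isoIsPullback_hom_fst, hP.lift_snd _ _ hτ]

/-- **`𝒴 ×_S 𝒳 ⟶ S` is a smooth projective family of relative dimension `d' + d`** (base change of `g`, composed with `f`;
fibres `𝒴_s × 𝒳_s`). [folklore] -/
theorem isSmoothProjectiveFamily_familyPullback_snd_comp {g : 𝒴 ⟶ S} {f : 𝒳 ⟶ S} {d' d : ℕ}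
    (hg : IsSmoothProjectiveFamily g d') (hf : IsSmoothProjectiveFamily f d) :
    IsSmoothProjectiveFamily (familyPullback.snd g f ≫ f) (d' + d) := by
  have hπ : IsSmoothProjectiveFamily (familyPullback.snd g f) d' := hg.familyPullback_snd f
  haveI : IsProper f.left := hf.isProper
  haveI : IsProper (familyPullback.snd g f).left := hπ.isProper
  haveI := hf.smoothOfRelativeDimension
  haveI := hπ.smoothOfRelativeDimension
  refine ⟨?_, ?_, fun s ↦ ?_⟩
  · change SmoothOfRelativeDimension (d' + d) ((familyPullback.snd g f).left ≫ f.left)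
    infer_instance
  · change IsProper ((familyPullback.snd g f).left ≫ f.left)
    infer_instance
  · obtain ⟨e, -⟩ := exists_fiberOver_familyPullback_iso g f s
    exact (IsSmoothProjective.tensor_holds (hg.isSmoothProjective s) (hf.isSmoothProjective s)).of_iso e

/-- **The total space `𝒴 ×_S 𝒳` of the fibre product of two smooth projective families over a smooth projective base, with
smooth projective total spaces, is a smooth projective `(d' + (d + 1))`-fold.** Smooth: `𝒴 ×_S 𝒳 → 𝒴 → Spec ℂ` (a base
change of `f`, then `𝒴`); projective: `(ι, g) : 𝒴 ⟶ ℙᴺ × S` is a closed immersion for a projective embedding `ι` of `𝒴`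
and a smooth projective (separated) `S`, so its base change `𝒴 ×_S 𝒳 ⟶ ℙᴺ × 𝒳` is one
(`exists_isClosedImmersion_familyPullback`), into the projective `ℙᴺ × 𝒳` (Segre); geometrically irreducible: the smooth
projective family `𝒴 ×_S 𝒳 ⟶ 𝒳` over the irreducible `𝒳` has irreducible total space
(`irreducibleSpace_of_isSmoothProjectiveFamily`), which is reduced, hence integral, hence geometrically integral over `ℂ`.
[cite: Hartshorne1977, II §4 (p. 103) and II Ex. 4.9] [cite: GortzWedhorn2020, Prop. 14.57 and Cor. 13.72] [cite: Liu2002, Ch. 4 Prop. 3.8] -/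
theorem isSmoothProjective_familyPullback_of_pencils {g : 𝒴 ⟶ S} {f : 𝒳 ⟶ S} {d' d m : ℕ} (hS : IsSmoothProjective m S)
    (h𝒴 : IsSmoothProjective (d' + m) 𝒴) (h𝒳 : IsSmoothProjective (d + m) 𝒳) (hg : IsSmoothProjectiveFamily g d') :
    IsSmoothProjective (d' + (d + m)) (familyPullback g f) := by
  have hπ : IsSmoothProjectiveFamily (familyPullback.snd g f) d' := hg.familyPullback_snd f
  -- smooth of relative dimension `d' + (d + m)` over `ℂ`: through `𝒳`
  haveI := h𝒳.smoothOfRelativeDimension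
  haveI := hπ.smoothOfRelativeDimension
  haveI hXd : SmoothOfRelativeDimension (d' + (d + m)) (familyPullback g f).hom := by
    rw [← Over.w (familyPullback.snd g f)]
    infer_instance
  -- projective: closed in `ℙᴺ × 𝒳`
  have hproj : IsProjectiveOver (familyPullback g f) := by
    obtain ⟨N, ι, hι⟩ := h𝒴.isProjectiveOver
    haveI := hι
    haveI := isClosedImmersion_lift_left_of_isSmoothProjective hS ι g
    obtain ⟨N', ι', hι', -⟩ := exists_isClosedImmersion_familyPullback g f
      ⟨N, CartesianMonoidalCategory.lift ι g, inferInstance, lift_snd _ _⟩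
    haveI := hι'
    exact Resolution.isProjectiveOver_of_isClosedImmersion_left ι'
      ((isSmoothProjective_projectiveSpace_holds ℂ N').isProjectiveOver.tensor h𝒳.isProjectiveOver)
  -- geometrically irreducible
  haveI : IrreducibleSpace 𝒳.left := h𝒳.irreducibleSpace
  haveI : IsProper 𝒳.hom := IsSmoothProjective.isProper_holds h𝒳
  haveI : LocallyOfFiniteType 𝒳.hom := inferInstance
  haveI : IrreducibleSpace (familyPullback g f).left :=
    irreducibleSpace_of_isSmoothProjectiveFamily (familyPullback.snd g f) hπ
  haveI : Smooth (familyPullback g f).hom := SmoothOfRelativeDimension.smooth (d' + (d + m)) _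
  haveI : IsReduced (familyPullback g f).left := Motives.isReduced_of_smooth_over_field (familyPullback g f).hom
  haveI : IsIntegral (familyPullback g f).left := isIntegral_of_irreducibleSpace_of_isReduced _
  haveI := geometricallyIntegral_of_isAlgClosed (familyPullback g f).hom
  exact ⟨hXd, hproj, inferInstance⟩

/-- **The fibre product `𝒴 ×_S 𝒳 ⟶ S` of two compact pencils of abelian varieties over the same curve is a compact pencil of
abelian varieties of relative dimension `d' + d`**: zero section `(e', e)`, smooth projective total space (above), smooth
projective family (above), fibres `(𝒴 ×_S 𝒳)_s ≅ 𝒴_s × 𝒳_s ≅ B_s × A_s` abelian. [cite: MumfordGIT, Thm. 6.14]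
[cite: Andre1996Motifs, §6.3 footnote (2) (p. 31)] -/
theorem isCompactAbelianPencil_familyPullback_snd_comp {g : 𝒴 ⟶ S} {f : 𝒳 ⟶ S} {d' d : ℕ}
    (hg : IsCompactAbelianPencil g d') (hf : IsCompactAbelianPencil f d) :
    IsCompactAbelianPencil (familyPullback.snd g f ≫ f) (d' + d) := by
  have hP : IsPullback (familyPullback.fst g f) (familyPullback.snd g f) g f := familyPullback.isPullback g f
  obtain ⟨e', he'⟩ := hg.exists_section
  obtain ⟨e, he⟩ := hf.exists_section
  have hee : e' ≫ g = e ≫ f := by rw [he', he]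
  have htot : IsSmoothProjective (d' + d + 1) (familyPullback g f) := by
    simpa only [Nat.add_assoc] using isSmoothProjective_familyPullback_of_pencils hf.isSmoothProjective_base
      hg.isSmoothProjective_total hf.isSmoothProjective_total hg.isSmoothProjectiveFamily
  refine .of_section (hP.lift e' e hee) ?_ hf.isSmoothProjective_base htot
    (isSmoothProjectiveFamily_familyPullback_snd_comp hg.isSmoothProjectiveFamily hf.isSmoothProjectiveFamily) fun s ↦ ?_
  · rw [← Category.assoc, hP.lift_snd, he]
  · obtain ⟨B, ⟨eB⟩⟩ := hg.exists_abelianVariety_fiber s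
    obtain ⟨A, ⟨eA⟩⟩ := hf.exists_abelianVariety_fiber s
    obtain ⟨e₀, -⟩ := exists_fiberOver_familyPullback_iso g f s
    exact ⟨B.prod A, ⟨tensorIso eB eA ≪≫ e₀⟩⟩

/-- **Common CM points are CM points of the fibre product**: if `𝒴_t ≅ B₀` and `𝒳_t ≅ A₀` are CM abelian varieties of
dimensions `d'`, `d`, then `(𝒴 ×_S 𝒳)_t ≅ B₀ × A₀` is a CM abelian variety of dimension `d' + d`. [cite: Deligne1982HodgeCycles, §6 proof of Prop. 6.1 (p. 73)] -/
theorem mem_cmLocus_familyPullback_snd_comp (g : 𝒴 ⟶ S) (f : 𝒳 ⟶ S) {d' d : ℕ} {t : ComplexPoints S}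
    (ht' : t ∈ cmLocus g d') (ht : t ∈ cmLocus f d) : t ∈ cmLocus (familyPullback.snd g f ≫ f) (d' + d) := by
  obtain ⟨B₀, ⟨eB⟩, hdimB, hcmB⟩ := ht'
  obtain ⟨A₀, ⟨eA⟩, hdimA, hcmA⟩ := ht
  obtain ⟨e₀, -⟩ := exists_fiberOver_familyPullback_iso g f t
  exact ⟨B₀.prod A₀, ⟨tensorIso eB eA ≪≫ e₀⟩, by rw [AbelianVariety.dim_prod, hdimB, hdimA], hcmB.prod hcmA⟩

/-- The same in a prescribed relative dimension `n = d' + d`. [folklore] -/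
theorem mem_cmLocus_familyPullback_snd_comp_of_eq (g : 𝒴 ⟶ S) (f : 𝒳 ⟶ S) {d' d n : ℕ} (hn : d' + d = n)
    {t : ComplexPoints S} (ht' : t ∈ cmLocus g d') (ht : t ∈ cmLocus f d) :
    t ∈ cmLocus (familyPullback.snd g f ≫ f) n :=
  hn ▸ mem_cmLocus_familyPullback_snd_comp g f ht' ht

/-! ## §2 `𝒳` is an `S`-retract of `𝒴 ×_S 𝒳` through the zero section of `𝒴` -/

/-- **The slice `σ = (f ≫ e', 𝟙) : 𝒳 ⟶ 𝒴 ×_S 𝒳`** through a section `e'` of `g` is a section of the projection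
`snd : 𝒴 ×_S 𝒳 ⟶ 𝒳`: `σ ≫ snd = 𝟙`. [cite: Hartshorne1977, II.3 (p. 89)] -/
theorem exists_section_familyPullback_snd (g : 𝒴 ⟶ S) (f : 𝒳 ⟶ S) {e' : S ⟶ 𝒴} (he' : e' ≫ g = 𝟙 S) :
    ∃ σ : 𝒳 ⟶ familyPullback g f, σ ≫ familyPullback.snd g f = 𝟙 𝒳 := by
  have hP : IsPullback (familyPullback.fst g f) (familyPullback.snd g f) g f := familyPullback.isPullback g f
  have h : (f ≫ e') ≫ g = 𝟙 𝒳 ≫ f := by rw [Category.assoc, he', Category.comp_id, Category.id_comp]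
  exact ⟨hP.lift (f ≫ e') (𝟙 𝒳) h, hP.lift_snd _ _ h⟩

/-- Every compact pencil of abelian varieties `g : 𝒴 ⟶ S` makes `𝒳` an `S`-retract of `𝒴 ×_S 𝒳` (through its zero
section). [cite: MumfordGIT, Thm. 6.14] -/
theorem exists_section_familyPullback_snd_of_pencil {g : 𝒴 ⟶ S} {d' : ℕ} (hg : IsCompactAbelianPencil g d') (f : 𝒳 ⟶ S) :
    ∃ σ : 𝒳 ⟶ familyPullback g f, σ ≫ familyPullback.snd g f = 𝟙 𝒳 := by
  obtain ⟨e', he'⟩ := hg.exists_section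
  exact exists_section_familyPullback_snd g f he'

/-! ## §3 The descent along `𝒴 ×_S 𝒳 ⟶ 𝒳` (part XXXIII-a instantiated), and the fibre square -/

/-- **THE LIFT `(L)_t(p + d')` OF `𝒴 ×_S 𝒳 ⟶ S` GIVES THE LIFT `(L)_t(p)` OF `f`** (lattice form, same point `t`), for compact
pencils `g`, `f` of abelian varieties of relative dimensions `d'`, `d` over the same curve. FACT-FREE (part XXXIII-a
`comap_le_sup_of_retract` at the retract of §2). [cite: Fulton1998, Prop. 1.7 and Thm. 6.2 (a)] [cite: Milne2020HodgeClassesAV, Prop. 1 (p. 7)] -/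
theorem comap_le_sup_of_familyPullback {g : 𝒴 ⟶ S} {f : 𝒳 ⟶ S} {d' d : ℕ} (hg : IsCompactAbelianPencil g d')
    (hf : IsCompactAbelianPencil f d) {t : ComplexPoints S} {p : ℕ}
    (h : (algebraicClasses (fiberOver (familyPullback.snd g f ≫ f) t) (p + d')).comap
        (complexBetti.map (fiberι (familyPullback.snd g f ≫ f) t) (2 * (p + d'))).hom ≤
      algebraicClasses (familyPullback g f) (p + d') ⊔
        LinearMap.ker (complexBetti.map (fiberι (familyPullback.snd g f ≫ f) t) (2 * (p + d'))).hom) :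
    (algebraicClasses (fiberOver f t) p).comap (complexBetti.map (fiberι f t) (2 * p)).hom ≤
      algebraicClasses 𝒳 p ⊔ LinearMap.ker (complexBetti.map (fiberι f t) (2 * p)).hom := by
  haveI : IsProper S.hom := IsSmoothProjective.isProper_holds hf.isSmoothProjective_base
  obtain ⟨σ, hσ⟩ := exists_section_familyPullback_snd_of_pencil hg f
  exact comap_le_sup_of_retract hf.isSmoothProjective_total
    (isSmoothProjective_familyPullback_of_pencils hf.isSmoothProjective_base hg.isSmoothProjective_total
      hf.isSmoothProjective_total hg.isSmoothProjectiveFamily)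
    hf.isSmoothProjectiveFamily
    (isSmoothProjectiveFamily_familyPullback_snd_comp hg.isSmoothProjectiveFamily hf.isSmoothProjectiveFamily) hσ h

/-- **TRANSPORT from `t` to `s` in degree `2(p + d')` along `𝒴 ×_S 𝒳 ⟶ S` gives transport from `t` to `s` in degree `2p`
along `f`.** FACT-FREE (part XXXIII-a `comap_le_comap_of_retract`). [cite: Fulton1998, Prop. 1.7 and Thm. 6.2 (a)]
[cite: Abdulali1994FamiliesAV, (1.1) (p. 1122)] -/
theorem comap_le_comap_of_familyPullback {g : 𝒴 ⟶ S} {f : 𝒳 ⟶ S} {d' d : ℕ} (hg : IsCompactAbelianPencil g d')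
    (hf : IsCompactAbelianPencil f d) {t s : ComplexPoints S} {p : ℕ}
    (h : (algebraicClasses (fiberOver (familyPullback.snd g f ≫ f) t) (p + d')).comap
        (complexBetti.map (fiberι (familyPullback.snd g f ≫ f) t) (2 * (p + d'))).hom ≤
      (algebraicClasses (fiberOver (familyPullback.snd g f ≫ f) s) (p + d')).comap
        (complexBetti.map (fiberι (familyPullback.snd g f ≫ f) s) (2 * (p + d'))).hom) :
    (algebraicClasses (fiberOver f t) p).comap (complexBetti.map (fiberι f t) (2 * p)).hom ≤
      (algebraicClasses (fiberOver f s) p).comap (complexBetti.map (fiberι f s) (2 * p)).hom := by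
  haveI : IsProper S.hom := IsSmoothProjective.isProper_holds hf.isSmoothProjective_base
  obtain ⟨σ, hσ⟩ := exists_section_familyPullback_snd_of_pencil hg f
  exact comap_le_comap_of_retract hf.isSmoothProjective_total
    (isSmoothProjective_familyPullback_of_pencils hf.isSmoothProjective_base hg.isSmoothProjective_total
      hf.isSmoothProjective_total hg.isSmoothProjectiveFamily)
    hf.isSmoothProjectiveFamily
    (isSmoothProjectiveFamily_familyPullback_snd_comp hg.isSmoothProjectiveFamily hf.isSmoothProjectiveFamily) hσ h

/-- **The fibre square `𝒳 ×_S 𝒳 ⟶ S` of a compact pencil of abelian `d`-folds is a compact pencil of abelian `2d`-folds**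
(prescribed relative dimension `n`, e.g. `n = 2 * d` or `n = d + d`). [cite: MumfordGIT, Thm. 6.14] -/
theorem isCompactAbelianPencil_square {f : 𝒳 ⟶ S} {d n : ℕ} (hf : IsCompactAbelianPencil f d) (hn : d + d = n) :
    IsCompactAbelianPencil (familyPullback.snd f f ≫ f) n :=
  hn ▸ isCompactAbelianPencil_familyPullback_snd_comp hf hf

/-- A CM point of `f` is a CM point of its fibre square (`𝒳_t × 𝒳_t` is CM with `𝒳_t`). [cite: Deligne1982HodgeCycles, §6 proof of Prop. 6.1 (p. 73)] -/
theorem mem_cmLocus_square (f : 𝒳 ⟶ S) {d n : ℕ} (hn : d + d = n) {t : ComplexPoints S} (ht : t ∈ cmLocus f d) :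
    t ∈ cmLocus (familyPullback.snd f f ≫ f) n :=
  mem_cmLocus_familyPullback_snd_comp_of_eq f f hn ht ht

/-- **THE LIFT `(L)_t(p + d)` OF THE FIBRE SQUARE GIVES THE LIFT `(L)_t(p)` OF `f`.** FACT-FREE.
[cite: Fulton1998, Prop. 1.7 and Thm. 6.2 (a)] [cite: Milne2020HodgeClassesAV, Prop. 1 (p. 7)] -/
theorem comap_le_sup_of_square {f : 𝒳 ⟶ S} {d : ℕ} (hf : IsCompactAbelianPencil f d) {t : ComplexPoints S} {p : ℕ}
    (h : (algebraicClasses (fiberOver (familyPullback.snd f f ≫ f) t) (p + d)).comap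
        (complexBetti.map (fiberι (familyPullback.snd f f ≫ f) t) (2 * (p + d))).hom ≤
      algebraicClasses (familyPullback f f) (p + d) ⊔
        LinearMap.ker (complexBetti.map (fiberι (familyPullback.snd f f ≫ f) t) (2 * (p + d))).hom) :
    (algebraicClasses (fiberOver f t) p).comap (complexBetti.map (fiberι f t) (2 * p)).hom ≤
      algebraicClasses 𝒳 p ⊔ LinearMap.ker (complexBetti.map (fiberι f t) (2 * p)).hom :=
  comap_le_sup_of_familyPullback hf hf h

/-- **TRANSPORT in degree `2(p + d)` along the fibre square gives transport in degree `2p` along `f`.** FACT-FREE.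
[cite: Fulton1998, Prop. 1.7 and Thm. 6.2 (a)] [cite: Abdulali1994FamiliesAV, (1.1) (p. 1122)] -/
theorem comap_le_comap_of_square {f : 𝒳 ⟶ S} {d : ℕ} (hf : IsCompactAbelianPencil f d) {t s : ComplexPoints S} {p : ℕ}
    (h : (algebraicClasses (fiberOver (familyPullback.snd f f ≫ f) t) (p + d)).comap
        (complexBetti.map (fiberι (familyPullback.snd f f ≫ f) t) (2 * (p + d))).hom ≤
      (algebraicClasses (fiberOver (familyPullback.snd f f ≫ f) s) (p + d)).comap
        (complexBetti.map (fiberι (familyPullback.snd f f ≫ f) s) (2 * (p + d))).hom) :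
    (algebraicClasses (fiberOver f t) p).comap (complexBetti.map (fiberι f t) (2 * p)).hom ≤
      (algebraicClasses (fiberOver f s) p).comap (complexBetti.map (fiberι f s) (2 * p)).hom :=
  comap_le_comap_of_familyPullback hf hf h

end Summit.HodgeConjecture.HodgeConjecture.Ring2.AbelianAll

end
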